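import Summits.QuantumFields.YangMills.Theorems.BalabanUVNodesKLCPrOfB7Prop5
import Summits.QuantumFields.YangMills.Theorems.BalabanUVNodesC44IterMhHierFrameGLLocality
import Literature.MathematicalPhysics.QuantumFieldTheory.Balaban1983to89.Node00.BgHierFrameGLOfRecord
import Literature.MathematicalPhysics.QuantumFieldTheory.Balaban1983to89.Node00.BgConstraintOfRecord
import HarnessLib

/-!
# THE JUNCTION PIN ON `GL(N, ℂ)` (director-ym g24 №628 (1)): hand-KLC's (KL-C)^{pr} ∕ [B11] PROP. 4 DOORS (✓`…KLCPrOfB7Prop5` §5) READ AT node00-def-Y's COMPLETED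
# INHABITANT `𝔥ᴳᴸ := fun K k U₀ => hierFrameGLDatumOfRecord F N k U₀` ((A1′) ✓`Node00.BgHierFrameGLOfRecord`), (hmap)∕(hderiv) DISCHARGED, AND THE HONESTY ROWS AT `U₀ = 1`

Cell `pub-ymgap` ∕ `ym-nodeO-ideate`, porter lineage `ymgap-nodeO-port-PTB-1` (gen 10); `--kind proof --supports stmt-QuantumFields-27238 --as helper`; count-neutral; NEW basename,
theorems only; the GL twin of ✓`…KLCPrAtHierFrame` (node00-def-RR-2's recommendation: one datum of record = the GL completion).  [B7] = [Balaban1985Averaging];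
[B9] = [Balaban1985BackgroundPropagators]; [B11] = [Balaban1985Variational].

WHAT THIS FILE DOES.
* §1 ★★ `kernelLetterC_of_prop5Clause_hierFrameGL` ∕ ★★★ `prop4UniformPrAtRecord_node00_of_prop5Clause_hierFrameGL` — hand-KLC's two §5 doors at `𝔥ᴳᴸ`, the displayed
  block-locality binders (hmap)∕(hderiv) DISCHARGED by ✓`…C44IterMhHierFrameGLLocality`; every other letter verbatim with `𝔥 K k U₀ ↦ hierFrameGLDatumOfRecord F N k U₀`; the frame
  WINDOW ∕ NEAR-ONE debts `hc : c𝔥 ≤ 1000`, (hdom), (hnear) STAY DISPLAYED ([B7] (81), (101)–(112) — owned by this lineage per №628 (3), not yet proved).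
* §2 THE HONESTY ROWS ON THE GUARD AT THE FLAT BACKGROUND: at `U₀ = 1` the guard holds (lit ✓`smallBelow_avOfRecord_one`), so `𝔥ᴳᴸ K k 1` is the GENUINE completed frame
  (`hierFrameGLDatumOfRecord_one_map`∕`_inv`∕`_dom`), with ★ `hierFrameGL_deriv_gauge_one` ((F1) for EVERY matrix `λ`, no trace hypothesis) and ★ `frameIntertwinesTokSL_hierFrameGL_one`
  ((3.114) on traceless `λ`) unconditionally — the frame-free negative ✓`not_B7Prop5Printed_kexpOfRecordPr_frameless` does not transfer through the guard.  The ALL-MATRIX token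
  `FrameIntertwinesTok … (hierFrameGLDatumOfRecord …)` (def-Y's `frameIntertwinesTok_hierFrameGL_of_scalarRow` + the Summits-side scalar row) is dag-n07-w3's pen, not restated here.

HONEST FRAMING.  Glue by name plus def-Y's identities read at `U₀ = 1`; NO estimate of [B7]∕[B9]∕[B11] is proved here; `B7.Prop5Printed (kexpOfRecordPr F N 𝔥ᴳᴸ)` NOT proved (nor
refuted); (T1)∕(T2) NOT discharged; K0ᴬ ⟨stmt-QuantumFields-27238⟩ NOT closed; NODE O 0∕1; COUNT 8∕28 · K 1∕4 UNMOVED; finite `𝕋⁴_{L^K}` at fixed ε — NOT continuum ∕ OS ∕ Clay;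
**the Yang–Mills mass gap (Clay) is NOT proved by any of this.**  No `sorry`, `def`, `instance`, `notation`, `set_option`; standard axioms.
-/

noncomputable section

open scoped Matrix Matrix.Norms.L2Operator InnerProductSpace ComplexConjugate BigOperators
open Classical

namespace Summit.QuantumFields.YangMills.Theorems.KExpOfRecordPr

open Literature.MathematicalPhysics.QuantumFieldTheory.Balaban1983to89
open Literature.MathematicalPhysics.QuantumFieldTheory.Balaban1983to89.Node00
open Summit.QuantumFields.YangMills.Theorems.KExpOfRecord (KRecIdx kexpOfRecord)
open T4Continuum BlockAveraging
open B10Eq42TorusConstraint (bondsIn)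
open B10Eq38TorusDomains (toFine)
open B11Eq103H1Complex (SiteL2K)
open B9SectCLatticeCarrier (Bond)
open B11Eq115Space (NegSup NegSize JetSup levWeight levWeight_apply)
open B11Eq90Transpose (single115)
open B11Eq90V0primeCurrent (flat115)
open B11Eq111FrakG (nabla115)
open B15AveragingHolomorphic (iterMh)
open B15DeterminingSets (embIter)

variable (F : T4Family) (N : ℕ) [NeZero N]

/-! ## §1  hand-KLC's §5 doors at the completed inhabitant family, (hmap)∕(hderiv) discharged -/

/-- ★★ **G1's (KL-C)^{pr} TRIPLE FROM THE (157) CLAUSE, AT THE RECORD'S COMPLETED FRAME** — hand-KLC's ✓`kernelLetterC_of_prop5Clause_pr` at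
`𝔥 := fun K k U₀ => hierFrameGLDatumOfRecord F N k U₀`, the frame block-locality (hmap)∕(hderiv) supplied by ✓`…C44IterMhHierFrameGLLocality`.
[cite: Balaban1985Averaging, Proposition 5 (157) p.42, p.24, (82)–(88) pp.30–31, (92) p.31; Balaban1985Variational, (73) p.289, (86) p.291, p.307] -/
theorem kernelLetterC_of_prop5Clause_hierFrameGL {K k : ℕ} (hk : k ≤ (F.P K).m + (F.P K).K) {Ω : ℕ → Set (Site (F.P K) 0)} {U₀ : GaugeField (F.P K) 0 (SU N)}
    [Fact (0 < (F.L : ℝ))] [Fact (0 < (F.P K).eta k)] (levB : PBond (F.P K) k → ℕ) (hΩ : ∀ x, x ∈ Ω k) (hsm : SmallBelow (avOfRecord F N K) k U₀)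
    {C₃ α₀ α₁ : ℝ} (hC₃ : 0 ≤ C₃) (hα₀ : 0 < α₀)
    (h157 : ∀ (i : KRecIdx F) (U₀ : (kexpOfRecordPr F N (fun K k (U₀ : GaugeField (F.P K) 0 (SU N)) => hierFrameGLDatumOfRecord F N k U₀) i).Cfg), (kexpOfRecordPr F N (fun K k (U₀ : GaugeField (F.P K) 0 (SU N)) => hierFrameGLDatumOfRecord F N k U₀) i).plaqDevEta U₀ < α₀ →
      ∀ A : (kexpOfRecordPr F N (fun K k (U₀ : GaugeField (F.P K) 0 (SU N)) => hierFrameGLDatumOfRecord F N k U₀) i).Fld, (kexpOfRecordPr F N (fun K k (U₀ : GaugeField (F.P K) 0 (SU N)) => hierFrameGLDatumOfRecord F N k U₀) i).fldNorm A < α₁ → (kexpOfRecordPr F N (fun K k (U₀ : GaugeField (F.P K) 0 (SU N)) => hierFrameGLDatumOfRecord F N k U₀) i).dCk U₀ A ≤ C₃ * (kexpOfRecordPr F N (fun K k (U₀ : GaugeField (F.P K) 0 (SU N)) => hierFrameGLDatumOfRecord F N k U₀) i).fldNorm A)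
    (hU₀ : PlaqSmall (α₀ * (F.P K).eta k ^ 2) U₀) :
    (∀ (c : PBond (F.P K) k) (bb : Bond (F.P K).d (fun _ => (F.P K).sitesPerDir 0)),
      0 ≤ (if (bondToLit (F.P K) 0).symm bb ∈ bondsIn 0 {x : Site (F.P K) 0 | B14.Eq22Determines.blockIter k x = c.src ∨ B14.Eq22Determines.blockIter k x = c.tgt}
        then C₃ * (F.P K).eta k ^ (F.P K).d else 0)) ∧
    (∀ A : Space115Lit F N K k Ω U₀, ‖A‖ < α₁ → ∀ (bb : Bond (F.P K).d (fun _ => (F.P K).sitesPerDir 0)) (X : Matrix (Fin N) (Fin N) ℂ) (c : PBond (F.P K) k),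
      ‖NegSup.equiv (levWeight (F.L : ℝ) ((F.P K).eta k) levB 0) (Matrix (Fin N) (Fin N) ℂ)
        (fderiv ℂ (CslprOfRecord F N K k Ω U₀ (hierFrameGLDatumOfRecord F N k U₀) levB) A (single115 (lev₁ := pairLevLit F Ω k) (Dc := nabla115 ((F.P K).eta k) (unitsOfRecord F N U₀)) bb X)) c‖ ≤
        (if (bondToLit (F.P K) 0).symm bb ∈ bondsIn 0 {x : Site (F.P K) 0 | B14.Eq22Determines.blockIter k x = c.src ∨ B14.Eq22Determines.blockIter k x = c.tgt}
          then C₃ * (F.P K).eta k ^ (F.P K).d else 0) * ‖A‖ * ‖X‖) ∧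
    (∀ bb : Bond (F.P K).d (fun _ => (F.P K).sitesPerDir 0),
      (∑ c : PBond (F.P K) k, (if (bondToLit (F.P K) 0).symm bb ∈ bondsIn 0 {x : Site (F.P K) 0 | B14.Eq22Determines.blockIter k x = c.src ∨ B14.Eq22Determines.blockIter k x = c.tgt}
        then C₃ * (F.P K).eta k ^ (F.P K).d else 0)) ≤ 2 * ((F.P K).d : ℝ) * (C₃ * (F.P K).eta k ^ (F.P K).d)) :=
  kernelLetterC_of_prop5Clause_pr F N (fun K k (U₀ : GaugeField (F.P K) 0 (SU N)) => hierFrameGLDatumOfRecord F N k U₀) hk levB hΩ hsm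
    (C44IterMh.hierFrameGLDatumOfRecord_map_inv_congr_of_eqOn_bondsIn F N k U₀ hk) (C44IterMh.hierFrameGLDatumOfRecord_deriv_congr_of_eqOn_bondsIn F N k U₀ hk)
    hC₃ hα₀ h157 hU₀

section Prop4

variable (K k : ℕ) (Ω : ℕ → Set (Site (F.P K) 0)) (U₀ : GaugeField (F.P K) 0 (SU N))
variable [Fact (0 < (F.L : ℝ))] [Fact (0 < (F.P K).eta k)] [Fact (0 < c0Rec F K k)] [Fact (∀ c, 0 < wBRec F K k c)]

/-- ★★★ **[B11] PROP. 4 (97)–(98) AT THE RECORD (NODE-00) ON THE CHART FRAMED BY THE RECORD'S COMPLETED (`GL`) HIERARCHICAL FRAME, (KL-C)^{pr} BLOCK := [B7] PROP. 5 (157)** —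
hand-KLC's ✓`prop4UniformPrAtRecord_node00_of_prop5Clause_pr` at `𝔥 := fun K k U₀ => hierFrameGLDatumOfRecord F N k U₀` with the frame block-locality (hmap)∕(hderiv) DISCHARGED
(✓`…C44IterMhHierFrameGLLocality`).  Remaining DISPLAYED letters, verbatim: (ℓa-H)ᵖʳ `hH`, (KL-H)ᵖʳ, (KL-N)ᵖʳ, `‖J‖ ≤ nJ`, `hpos`∕`hQ` at `QprOfRecord … (hierFrameGLDatumOfRecord …)`,
the (157) clause `h157` of `B7.Prop5Printed (kexpOfRecordPr F N 𝔥ᴳᴸ)` with `r + r ≤ α₁` and the window `hq`, AND the frame WINDOW∕NEAR-ONE debts `hc : c𝔥 ≤ 1000`, (hdom), (hnear)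
for `hierFrameGLDatumOfRecord F N k U₀` ([B7] (81), (101)–(112) — NOT in the tree).  HONEST: glue; NO estimate of [B7]∕[B9]∕[B11] is proved here.
[cite: Balaban1985Variational, Prop. 4 (97)–(98) pp.292–293, (72)–(73) p.289, (86)–(89) p.291, (14) p.280, p.307; Balaban1985Averaging, Proposition 5 (157) p.42, (52) p.26, (81) p.30, (84)–(88) pp.30–31, (92) p.31, (138) p.39; Balaban1985BackgroundPropagators, (3.113)–(3.114) p.418, (3.132) p.422] -/
theorem prop4UniformPrAtRecord_node00_of_prop5Clause_hierFrameGL [DecidableEq (PBond (F.P K) k)] (levB : PBond (F.P K) k → ℕ) (a : ℝ)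
    (hpos : ∀ x, x ≠ 0 → 0 < RCLike.re ⟪x, laplaceAOfRecord F N k U₀ (QprOfRecord F N k U₀ (hierFrameGLDatumOfRecord F N k U₀)) (QprimeOfRecord F N k U₀) a x⟫_ℂ)
    (hQ : Function.Surjective (QprOfRecord F N k U₀ (hierFrameGLDatumOfRecord F N k U₀)))
    (Gp : SiteL2K ℂ (F.P K).d (fun _ => (F.P K).sitesPerDir 0) (c0Rec F K k) (WRec N) →ₗ[ℂ]
      SiteL2K ℂ (F.P K).d (fun _ => (F.P K).sitesPerDir 0) (c0Rec F K k) (WRec N))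
    {b α nJ : ℝ} (hkpos : 0 < k) (hkm : k ≤ (F.P K).m + (F.P K).K) (hb : 0 ≤ b) (hΩ : ∀ x, x ∈ Ω k) (hαpos : 0 < α) (hα : α * (11000000 * N) ≤ 1)
    (hreg : ∀ j, j < k → PlaqSmall (α * ((F.L : ℝ) ^ j * (F.P K).eta k) ^ 2) (Averaging.iter (avOfRecord F N K) j U₀))
    {c𝔥 : ℝ} (hc : c𝔥 ≤ 1000)
    (hdom : ∀ Y : PBond (F.P K) 0 → Matrix (Fin N) (Fin N) ℂ, (∀ b, (Y b).trace = 0) → (F.L : ℝ) ^ k * ‖Y‖ < 1 / (25000000000 * (F.L : ℝ) * N) →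
      expOver U₀ Y ∈ (hierFrameGLDatumOfRecord F N k U₀).dom)
    (hnear : ∀ Y : PBond (F.P K) 0 → Matrix (Fin N) (Fin N) ℂ, (∀ b, (Y b).trace = 0) → (F.L : ℝ) ^ k * ‖Y‖ < 1 / (25000000000 * (F.L : ℝ) * N) →
      ∀ y : Site (F.P K) k, ‖(hierFrameGLDatumOfRecord F N k U₀).map (expOver U₀ Y) y - 1‖ ≤ c𝔥 * ((F.L : ℝ) ^ k * ‖Y‖) ∧ ‖(hierFrameGLDatumOfRecord F N k U₀).inv (expOver U₀ Y) y - 1‖ ≤ c𝔥 * ((F.L : ℝ) ^ k * ‖Y‖))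
    (hH : Prop4LetterHPrAtRecord F N K k Ω U₀ (hierFrameGLDatumOfRecord F N k U₀) levB a hpos hQ b)
    -- (KL-H)ᵖʳ
    {hk : Bond (F.P K).d (fun _ => (F.P K).sitesPerDir 0) → PBond (F.P K) k → ℝ} (hk0 : ∀ b' y, 0 ≤ hk b' y)
    (hHk : ∀ (y : PBond (F.P K) k) (Z : Matrix (Fin N) (Fin N) ℂ) (b' : Bond (F.P K).d (fun _ => (F.P K).sitesPerDir 0)),
      ‖flat115 (H1prOfRecordAtBg F N K k Ω U₀ (hierFrameGLDatumOfRecord F N k U₀) levB a hpos hQ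
          ((NegSup.equiv (levWeight (F.L : ℝ) ((F.P K).eta k) levB 0) (Matrix (Fin N) (Fin N) ℂ)).symm (Pi.single y Z))) b'‖ ≤ hk b' y * ‖Z‖)
    {ΘH : ℝ} (hΘH : 0 ≤ ΘH) (hH1 : ∀ y, ∑ b', hk b' y ≤ ΘH) {ΘHw : ℝ} (hΘHw : 0 ≤ ΘHw)
    (hHw : ∀ (bb : Bond (F.P K).d (fun _ => (F.P K).sitesPerDir 0)) (y : PBond (F.P K) k),
      ∑ b', levWeight (F.L : ℝ) ((F.P K).eta k) (bondLevLit F Ω k) 3 bb / levWeight (F.L : ℝ) ((F.P K).eta k) (bondLevLit F Ω k) 3 b' * hk b' y ≤ ΘHw)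
    -- (KL-C)ᵖʳ := the (157) clause of `B7.Prop5Printed (kexpOfRecordPr F N 𝔥ᴳᴸ)` at `(α, α₁, C₃)`, `r + r ≤ α₁`, and the window
    {C₃ α₁ : ℝ} (hC₃ : 0 ≤ C₃)
    (h157 : ∀ (i : KRecIdx F) (U₀ : (kexpOfRecordPr F N (fun K k (U₀ : GaugeField (F.P K) 0 (SU N)) => hierFrameGLDatumOfRecord F N k U₀) i).Cfg), (kexpOfRecordPr F N (fun K k (U₀ : GaugeField (F.P K) 0 (SU N)) => hierFrameGLDatumOfRecord F N k U₀) i).plaqDevEta U₀ < α →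
      ∀ A : (kexpOfRecordPr F N (fun K k (U₀ : GaugeField (F.P K) 0 (SU N)) => hierFrameGLDatumOfRecord F N k U₀) i).Fld, (kexpOfRecordPr F N (fun K k (U₀ : GaugeField (F.P K) 0 (SU N)) => hierFrameGLDatumOfRecord F N k U₀) i).fldNorm A < α₁ → (kexpOfRecordPr F N (fun K k (U₀ : GaugeField (F.P K) 0 (SU N)) => hierFrameGLDatumOfRecord F N k U₀) i).dCk U₀ A ≤ C₃ * (kexpOfRecordPr F N (fun K k (U₀ : GaugeField (F.P K) 0 (SU N)) => hierFrameGLDatumOfRecord F N k U₀) i).fldNorm A)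
    (hrα₁ : letI C₂ : ℝ := 32000000000000000 * (F.L : ℝ) * N
      letI c₄ : ℝ := 1 / (200000000000 * (F.L : ℝ) * N)
      letI r : ℝ := min (c₄ / 4) (min (1 / 2) (1 / (16 * (b * C₂ + 1))))
      r + r ≤ α₁)
    (hq : letI C₂ : ℝ := 32000000000000000 * (F.L : ℝ) * N
      letI c₄ : ℝ := 1 / (200000000000 * (F.L : ℝ) * N)
      letI r : ℝ := min (c₄ / 4) (min (1 / 2) (1 / (16 * (b * C₂ + 1))))
      (r + r) * ΘH * (2 * ((F.P K).d : ℝ) * (C₃ * (F.P K).eta k ^ (F.P K).d)) ≤ 1 / 2)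
    -- (KL-N)ᵖʳ
    {hk' : Bond (F.P K).d (fun _ => (F.P K).sitesPerDir 0) → PBond (F.P K) k → ℝ} (hk'0 : ∀ b' y, 0 ≤ hk' b' y)
    (hNk : ∀ (y : PBond (F.P K) k) (Z : Matrix (Fin N) (Fin N) ℂ) (b' : Bond (F.P K).d (fun _ => (F.P K).sitesPerDir 0)),
      ‖NegSup.equiv (levWeight (F.L : ℝ) ((F.P K).eta k) (bondLevLit F Ω k) 3) (Matrix (Fin N) (Fin N) ℂ)
        (DeltaPiCurOfRecord F N K k Ω U₀ Gp (QprimeOfRecord F N k U₀) (H1prOfRecordAtBg F N K k Ω U₀ (hierFrameGLDatumOfRecord F N k U₀) levB a hpos hQ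
          ((NegSup.equiv (levWeight (F.L : ℝ) ((F.P K).eta k) levB 0) (Matrix (Fin N) (Fin N) ℂ)).symm (Pi.single y Z)))) b'‖ ≤ hk' b' y * ‖Z‖)
    {Θ' : ℝ} (hΘ'0 : 0 ≤ Θ')
    (hΘ' : ∀ (bb : Bond (F.P K).d (fun _ => (F.P K).sitesPerDir 0)) (y : PBond (F.P K) k),
      ∑ b', levWeight (F.L : ℝ) ((F.P K).eta k) (bondLevLit F Ω k) 3 bb / levWeight (F.L : ℝ) ((F.P K).eta k) (bondLevLit F Ω k) 1 b' * hk' b' y ≤ Θ')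
    {N₁ : ℝ} (hN₁0 : 0 ≤ N₁)
    (hN₁ : ∀ b', ∑ y, levWeight (F.L : ℝ) ((F.P K).eta k) (bondLevLit F Ω k) 3 b' / levWeight (F.L : ℝ) ((F.P K).eta k) levB 0 y * hk' b' y ≤ N₁)
    (hJ : ‖JOfRecordAtBg F N K k Ω U₀‖ ≤ nJ) :
    letI C₂ : ℝ := 32000000000000000 * (F.L : ℝ) * N
    letI c₄ : ℝ := 1 / (200000000000 * (F.L : ℝ) * N)
    letI r : ℝ := min (c₄ / 4) (min (1 / 2) (1 / (16 * (b * C₂ + 1))))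
    letI R' : ℝ := min r ((1 - 4 * b * C₂ * (r + r)) * (1 / 16))
    letI CV : ℝ := 1024 * (((F.P K).d - 1 : ℕ) : ℝ) * ((1 : ℝ) * 1) ^ 3 * N * (α * (1 : ℝ) ^ 2 + 1 / 16)
        + (((F.P K).d - 1 : ℕ) : ℝ) * ((1 : ℝ) * 1) ^ 3 * (136 + 2 * ((1 : ℝ) * 1)) * N
    letI G : ℝ := 2 * ((F.P K).d : ℝ) * (C₃ * (F.P K).eta k ^ (F.P K).d)
    letI θ₃ : ℝ := (2 * (1 / (1 - 4 * b * C₂ * (r + r))) + 1) * ΘHw * G / r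
    letI θE : ℝ := 2 * ΘHw * G * (1 / (1 - 4 * b * C₂ * (r + r)))
    letI θE' : ℝ := 2 * Θ' * G * (1 / (1 - 4 * b * C₂ * (r + r)))
    Prop4UniformPrAtRecord F N K k Ω U₀ (hierFrameGLDatumOfRecord F N k U₀) levB a hpos hQ r Gp
      ((N * θ₃ * nJ + (N₁ * C₂ * (1 / (1 - 4 * b * C₂ * (r + r))) ^ 2 + N * θE')
        + N * θE * (N₁ * C₂ * (1 / (1 - 4 * b * C₂ * (r + r))) ^ 2) * R'
        + N * (1 + θE * R') * CV * (1 / (1 - 4 * b * C₂ * (r + r))) ^ 2)) R' :=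
  prop4UniformPrAtRecord_node00_of_prop5Clause_pr F N (fun K k (U₀ : GaugeField (F.P K) 0 (SU N)) => hierFrameGLDatumOfRecord F N k U₀) K k Ω U₀ levB a hpos hQ Gp hkpos hkm hb hΩ hαpos hα hreg hc hdom hnear
    (C44IterMh.hierFrameGLDatumOfRecord_map_inv_congr_of_eqOn_bondsIn F N k U₀ hkm) (C44IterMh.hierFrameGLDatumOfRecord_deriv_congr_of_eqOn_bondsIn F N k U₀ hkm)
    hH hk0 hHk hΘH hH1 hΘHw hHw hC₃ h157 hrα₁ hq hk'0 hNk hΘ'0 hΘ' hN₁0 hN₁ hJ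

end Prop4

/-! ## §2  The honesty rows ON the guard at the flat background `U₀ = 1`, completed datum -/

section FlatBackground

variable {K : ℕ} (k : ℕ)

/-- At the flat background the guard holds, so `𝔥ᴳᴸ K k 1` is the GENUINE completed frame `e^{−f_k(σ_V)}·Ψ_k(V♮)`, not the frameless `1`.
[cite: Balaban1985Averaging, (84)–(88) pp.30–31; Balaban1985Variational, p.307; Balaban1987RG1, (0.4) p.253] -/
theorem hierFrameGLDatumOfRecord_one_map :
    (hierFrameGLDatumOfRecord F N k (1 : GaugeField (F.P K) 0 (SU N))).map = hierFrameGLMap F N k (1 : GaugeField (F.P K) 0 (SU N)) :=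
  hierFrameGLDatumOfRecord_map F N k 1 (smallBelow_avOfRecord_one F N k)

/-- At the flat background `inv = e^{f_k(σ_V)}·Φ_k(V♮)`. [cite: Balaban1985Averaging, (84)–(86) pp.30–31; Balaban1985Variational, p.307] -/
theorem hierFrameGLDatumOfRecord_one_inv :
    (hierFrameGLDatumOfRecord F N k (1 : GaugeField (F.P K) 0 (SU N))).inv = hierFrameGLInv F N k (1 : GaugeField (F.P K) 0 (SU N)) :=
  hierFrameGLDatumOfRecord_inv F N k 1 (smallBelow_avOfRecord_one F N k)

/-- At the flat background the window is `hierFrameGLDom` (log-discs of `σ` and the `♮`-preimage of the iterated polydisc), not `Set.univ`.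
[cite: Balaban1985Averaging, (81) p.30; Balaban1985Variational, Prop. 9 p.309] -/
theorem hierFrameGLDatumOfRecord_one_dom :
    (hierFrameGLDatumOfRecord F N k (1 : GaugeField (F.P K) 0 (SU N))).dom = hierFrameGLDom F N k (1 : GaugeField (F.P K) 0 (SU N)) :=
  hierFrameGLDatumOfRecord_dom F N k 1 (smallBelow_avOfRecord_one F N k)

/-- ★ **(F1) AT THE FLAT BACKGROUND FOR EVERY MATRIX DIRECTION, UNCONDITIONALLY**: the derivative letter of `𝔥ᴳᴸ K k 1` maps the gauge mode `leftVelC 1 (D_1λ)` to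
`λ∘emb^k − Q′_k(1)λ` — no trace hypothesis; nonzero on the one-site witness of Q-37, where the frameless letter is `0`.
[cite: Balaban1985BackgroundPropagators, (3.113)–(3.114) p.418, (3.18)–(3.19) p.393; Balaban1985Averaging, (84)–(88) pp.30–31; Balaban1985Variational, p.307] -/
theorem hierFrameGL_deriv_gauge_one (lam : Site (F.P K) 0 → Matrix (Fin N) (Fin N) ℂ) :
    (hierFrameGLDatumOfRecord F N k (1 : GaugeField (F.P K) 0 (SU N))).deriv
        (leftVelC (1 : GaugeField (F.P K) 0 (SU N)) fun b : PBond (F.P K) 0 =>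
          ((1 : GaugeField (F.P K) 0 (SU N)) b : Matrix (Fin N) (Fin N) ℂ) * lam b.tgt * star ((1 : GaugeField (F.P K) 0 (SU N)) b : Matrix (Fin N) (Fin N) ℂ) - lam b.src) =
      fun y => lam (embIter k y) - siteAvgIter (avOfRecord F N K) 1 k lam y :=
  hierFrameGL_deriv_gauge F N k 1 (smallBelow_avOfRecord_one F N k) lam

/-- ★ **(3.114) AT THE FLAT BACKGROUND ON TRACELESS `λ`, UNCONDITIONALLY**, for the completed datum. [cite: Balaban1985BackgroundPropagators, (3.113)–(3.115) p.418, (3.18)–(3.19) p.393; Balaban1985Averaging, (89) p.31, (92) p.31, Proposition 5 (156) p.42] -/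
theorem frameIntertwinesTokSL_hierFrameGL_one :
    FrameIntertwinesTokSL F N k (1 : GaugeField (F.P K) 0 (SU N)) (hierFrameGLDatumOfRecord F N k 1) :=
  frameIntertwinesTokSL_hierFrameGL F N k 1 (smallBelow_avOfRecord_one F N k)

end FlatBackground

end Summit.QuantumFields.YangMills.Theorems.KExpOfRecordPr

end
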